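import Summits.SmoothPoincare4.SmoothPoincare4.Theorems.SullivanDualHyperbolicEndTaubesModelDefs
import Summits.SmoothPoincare4.SmoothPoincare4.Theorems.SullivanDualHyperbolicEndTaubesModelIdentities

/-!
# Route `SullivanDual`, crux `HyperbolicEnd` (stmt-SmoothPoincare4-7825), line `taubes-circle-pencil`:
# the moment map `(Q, H)` of Taubes' untwisted model form

Registered helper `helper_taubesForm_momentMap` of the checked skeleton: the two contraction
identities `ι_{∂t} ωT = dQ` and `ι_{∂φ} ωT = dH` for Taubes' untwisted near-symplectic model form
`ωT = dt ∧ dQ + ⋆₃ dQ` on `S¹ × B³` (C. H. Taubes, Geom. Topol. 2 (1998) 221–332, §1, eq. (1.10):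
`ω = dt ∧ df + dφ ∧ dh` with `f = Q = ½(a² + b² − 2c²)`, `h = H = c (a² + b²)`, `φ = arg(a + ib)`),
i.e. the `ℝ_t × S¹_φ`-action is Hamiltonian with moment map `(f, h)` — the "toric chart"
`(t, φ, f, h)` in which `ω` is standard.  Everything is written with the explicit flat-coordinate
formulas of `Theorems/SullivanDualHyperbolicEndTaubesModelDefs.lean` (`y ∈ ℝ⁴`, `r = taubesR y`,
`a = r − 1`, `b = y₂`, `c = y₃`, `∂_t = (−y₁, y₀, 0, 0)`, `∂_a = (y₀, y₁, 0, 0)/r`,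
`∂_φ = a ∂_b − b ∂_a`), off the axis `r = 0`:

* `taubesForm y ∂_t v = taubesDQ y v`;
* `taubesForm y (a e₂ − (b/r) (y₀, y₁, 0, 0)) v = (a² + b²) v₃ + 2c (a da(v) + b v₂) = dH(v)`.

Method: the toroidal components `(dt, da, (·)₂, (·)₃)` of the two explicit vectors are
`(1, 0, 0, 0)` and `(0, −b, a, 0)` (`field_simp` + `linear_combination` against `r² = y₀² + y₁²`,
`taubesR_sq`); substituting them into the defining formula of `taubesForm` leaves a `ring` identity.
Positivity of `r` is a hypothesis here (on a tube of radius `< 1` it is `helper_taubesR_pos`).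
Nothing about `J♭` or the closedness of `ωT` is in this file.
-/

-- the registered namespace `Summit.SmoothPoincare4.SmoothPoincare4.…` repeats a component (P = Sub)
set_option linter.dupNamespace false

noncomputable section

namespace Summit.SmoothPoincare4.SmoothPoincare4.Cruxes.HyperbolicEnd.TaubesCirclePencil

/-- `taubesForm y u v` expressed through the toroidal components `dt(u)`, `da(u)`, `u₂`, `u₃` of its
first argument: the defining formula of `ωT` with these four numbers substituted. [folklore] -/
private theorem momentMap_taubesForm_of_components (y u v : EuclideanSpace ℝ (Fin 4))
    (t r u2 u3 : ℝ) (h0 : taubesDt y u = t) (h1 : taubesDa y u = r) (h2 : u 2 = u2)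
    (h3 : u 3 = u3) :
    taubesForm y u v =
      t * taubesDQ y v - taubesDt y v * ((taubesR y - 1) * r + y 2 * u2 - 2 * y 3 * u3)
        + (taubesR y - 1) * (u2 * v 3 - v 2 * u3)
        + y 2 * (u3 * taubesDa y v - v 3 * r)
        - 2 * y 3 * (r * v 2 - taubesDa y v * u2) := by
  subst h0 h1 h2 h3
  rfl

/-- Toroidal components of `∂_t = (−y₁, y₀, 0, 0)` off the axis: `dt(∂_t) = 1`, `da(∂_t) = 0`,
`(∂_t)₂ = (∂_t)₃ = 0`. [folklore] -/
private theorem momentMap_dt_components (y : EuclideanSpace ℝ (Fin 4)) (hr : 0 < taubesR y) :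
    taubesDt y (WithLp.toLp 2 ![-(y 1), y 0, 0, 0]) = 1 ∧
    taubesDa y (WithLp.toLp 2 ![-(y 1), y 0, 0, 0]) = 0 ∧
    (WithLp.toLp 2 ![-(y 1), y 0, 0, 0] : EuclideanSpace ℝ (Fin 4)) 2 = 0 ∧
    (WithLp.toLp 2 ![-(y 1), y 0, 0, 0] : EuclideanSpace ℝ (Fin 4)) 3 = 0 := by
  have hr0 : taubesR y ≠ 0 := hr.ne'
  have hsq := taubesR_sq y
  refine ⟨?_, ?_, ?_, ?_⟩
  · simp only [taubesDt, Matrix.cons_val_zero, Matrix.cons_val_one]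
    field_simp
    linear_combination (-1 : ℝ) * hsq
  · simp only [taubesDa, Matrix.cons_val_zero, Matrix.cons_val_one]
    ring
  · rfl
  · rfl

/-- Toroidal components of `∂_φ = a e₂ − (b/r) (y₀, y₁, 0, 0) = a ∂_b − b ∂_a` off the axis:
`dt(∂_φ) = 0`, `da(∂_φ) = −b`, `(∂_φ)₂ = a`, `(∂_φ)₃ = 0`. [folklore] -/
private theorem momentMap_dphi_components (y : EuclideanSpace ℝ (Fin 4)) (hr : 0 < taubesR y) :
    taubesDt y ((taubesR y - 1) • EuclideanSpace.single 2 1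
        - (y 2 / taubesR y) • WithLp.toLp 2 ![y 0, y 1, 0, 0]) = 0 ∧
    taubesDa y ((taubesR y - 1) • EuclideanSpace.single 2 1
        - (y 2 / taubesR y) • WithLp.toLp 2 ![y 0, y 1, 0, 0]) = -(y 2) ∧
    ((taubesR y - 1) • EuclideanSpace.single 2 1
        - (y 2 / taubesR y) • WithLp.toLp 2 ![y 0, y 1, 0, 0] : EuclideanSpace ℝ (Fin 4)) 2 =
      taubesR y - 1 ∧
    ((taubesR y - 1) • EuclideanSpace.single 2 1
        - (y 2 / taubesR y) • WithLp.toLp 2 ![y 0, y 1, 0, 0] : EuclideanSpace ℝ (Fin 4)) 3 = 0 := by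
  have hr0 : taubesR y ≠ 0 := hr.ne'
  have hsq := taubesR_sq y
  -- the four flat components of `∂_φ`
  have e0 : ((taubesR y - 1) • EuclideanSpace.single 2 1
      - (y 2 / taubesR y) • WithLp.toLp 2 ![y 0, y 1, 0, 0] : EuclideanSpace ℝ (Fin 4)) 0 =
        -(y 2 / taubesR y * y 0) := by
    simp [Matrix.cons_val_zero]
  have e1 : ((taubesR y - 1) • EuclideanSpace.single 2 1
      - (y 2 / taubesR y) • WithLp.toLp 2 ![y 0, y 1, 0, 0] : EuclideanSpace ℝ (Fin 4)) 1 =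
        -(y 2 / taubesR y * y 1) := by
    simp [Matrix.cons_val_one]
  have e2 : ((taubesR y - 1) • EuclideanSpace.single 2 1
      - (y 2 / taubesR y) • WithLp.toLp 2 ![y 0, y 1, 0, 0] : EuclideanSpace ℝ (Fin 4)) 2 =
        taubesR y - 1 := by
    simp [Matrix.cons_val]
  have e3 : ((taubesR y - 1) • EuclideanSpace.single 2 1
      - (y 2 / taubesR y) • WithLp.toLp 2 ![y 0, y 1, 0, 0] : EuclideanSpace ℝ (Fin 4)) 3 = 0 := by
    simp [Matrix.cons_val]
  refine ⟨?_, ?_, e2, e3⟩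
  · rw [taubesDt, e0, e1]
    ring
  · rw [taubesDa, e0, e1]
    field_simp
    linear_combination (y 2) * hsq

/-- **The moment map of Taubes' untwisted model** (Taubes 1998, §1, eq. (1.10):
`ωT = dt ∧ dQ + ⋆₃ dQ = dt ∧ df + dφ ∧ dh`, `f = Q = ½(a² + b² − 2c²)`, `h = H = c (a² + b²)`,
`φ = arg(a + ib)`; the `ℝ_t × S¹_φ`-action is Hamiltonian with moment map `(f, h)`), in the flat
coordinates of the Defs file and off the axis `taubesR y = 0`:
`ι_{∂t} ωT = dQ`, i.e. `taubesForm y (−y₁, y₀, 0, 0) v = taubesDQ y v`, and `ι_{∂φ} ωT = dH` with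
`∂_φ = a ∂_b − b ∂_a = (r − 1) e₂ − (y₂/r) (y₀, y₁, 0, 0)`, i.e.
`taubesForm y ∂_φ v = ((r − 1)² + y₂²) v₃ + 2 y₃ ((r − 1) da(v) + y₂ v₂)`.
[cite: Taubes1998S1B3, eq. (1.10)] -/
theorem helper_taubesForm_momentMap :
    ∀ (y : EuclideanSpace ℝ (Fin 4)), 0 < taubesR y →
      ∀ v : EuclideanSpace ℝ (Fin 4),
        taubesForm y (WithLp.toLp 2 ![-(y 1), y 0, 0, 0]) v = taubesDQ y v ∧
        taubesForm y ((taubesR y - 1) • EuclideanSpace.single 2 1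
            - (y 2 / taubesR y) • WithLp.toLp 2 ![y 0, y 1, 0, 0]) v =
          ((taubesR y - 1) ^ 2 + y 2 ^ 2) * v 3
            + 2 * y 3 * ((taubesR y - 1) * taubesDa y v + y 2 * v 2) := by
  intro y hr v
  obtain ⟨ht0, ht1, ht2, ht3⟩ := momentMap_dt_components y hr
  obtain ⟨hp0, hp1, hp2, hp3⟩ := momentMap_dphi_components y hr
  constructor
  · rw [momentMap_taubesForm_of_components y _ v _ _ _ _ ht0 ht1 ht2 ht3]
    ring
  · rw [momentMap_taubesForm_of_components y _ v _ _ _ _ hp0 hp1 hp2 hp3]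
    ring

end Summit.SmoothPoincare4.SmoothPoincare4.Cruxes.HyperbolicEnd.TaubesCirclePencil

end
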